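import Summits.AtomisticToContinuum.Crystallization.Theorems.BraggSlacknessRigidityStrictCertificateFlatness
import Summits.AtomisticToContinuum.Crystallization.Theorems.ThreeConeCertificateExactCertificateSecondMoment

/-!
# Crux `StrictCertificate` (stmt-AtomisticToContinuum-13167, route `BraggSlacknessRigidity`):
# necessary conditions on a witness, VIII — FINITE SECOND FOURIER MOMENT and `F ∈ C²(ℝ³)`

Support file for the line `registered` (lead c4); nothing here closes the item.  This is where the
Fourier-regularity conjuncts 10–13 of the crux (`F = f∘‖·‖` continuous and integrable on `ℝ³`, `𝓕F`
integrable, real and `≥ 0`) meet the flatness of the kernel forced by exactness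
(`…Flatness.f_zero_sub_f_le_mul_sq`: `0 ≤ f 0 − f r ≤ K r²` on `[0, δ]`).

* §1 (abstract, any continuous integrable `F : ℝ³ → ℂ` with integrable REAL transform):
  `re_eq_integral_cos_mul` — `Re F(x) = ∫ cos(2π⟪ξ,x⟫) Re 𝓕F(ξ) dξ` (Fourier inversion,
  `Continuous.fourierInv_fourier_eq`); `re_zero_sub_re_eq_integral` — the drop
  `Re F(0) − Re F(x) = ∫ (1 − cos(2π⟪ξ,x⟫)) Re 𝓕F(ξ) dξ`;
* `integrable_inner_sq_mul_fourier` — **FATOU**: if moreover `Re 𝓕F ≥ 0` and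
  `Re F(0) − Re F(r e) ≤ K r²` for `0 ≤ r ≤ δ`, then `ξ ↦ ⟪ξ,e⟫² Re 𝓕F(ξ)` is integrable with
  `∫ ⟪ξ,e⟫² Re 𝓕F ≤ K/(2π²)` (difference quotients along `r_n = δ/(n+1)`, pointwise limit
  `(1 − cos(rθ))/r² → θ²/2` from the sibling `…SecondMoment.tendsto_inv_sq_mul_cos_sub_one`,
  `lintegral_liminf_le'`);
* `integrable_norm_sq_mul_fourier` — summed over the coordinate axes: **`∫ ‖ξ‖² Re 𝓕F ≤ 3K/(2π²)`**;
* `contDiff_two_of_moments` — hence `F = 𝓕⁻(𝓕F) ∈ C²(ℝ³)` (`Real.contDiff_fourier`);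
* §2 application to the crux: `fourierSecondMoment_of_clauses` (registered sub-goal; conjuncts 2–7 and
  10–13 verbatim as hypotheses ⇒ `ξ ↦ ‖ξ‖² Re 𝓕F(ξ)` integrable), `contDiff_of_clauses` (`F ∈ C²`),
  and the quantitative `integral_norm_sq_mul_fourier_le_of_clauses`.

Why it matters: the one-sided radial interpolation problem W1 behind the crux (sibling census
`Cruxes/ExactCertificate/STRATEGY-CENSUS.md` §0) may henceforth be posed for `C²` kernels whose
non-negative transform has an explicitly bounded second moment — Hermite (tangential) contact data at
every shell are genuine, and `𝓕F(ξ) = O`-free decay statements become quantitative.  All `[folklore]`.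
-/

noncomputable section

namespace Summit.AtomisticToContinuum.Crystallization.Theorems.BraggSlacknessRigidityStrictCertificate

open Literature.MathematicalPhysics.StatisticalMechanics
open Summit.AtomisticToContinuum.Crystallization.Theorems.ExactCertificateNegative (IsSplit)
open Summit.AtomisticToContinuum.Crystallization.Theorems.ChargedEnergyGapNegative (E3)
open Summit.AtomisticToContinuum.Crystallization.Theorems.ThreeConeCertificateExactCertificate.Fourier
  (tendsto_inv_sq_mul_cos_sub_one)
open MeasureTheory Filter Topology
open scoped BigOperators RealInnerProductSpace FourierTransform

/-! ## §1 Second Fourier moment from flatness -/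

/-- The inverse-Fourier integrand of an integrable `Φ` is integrable. [folklore] -/
theorem integrable_exp_smul {Φ : E3 → ℂ} (hΦ : Integrable Φ) (x : E3) :
    Integrable fun ξ : E3 => Complex.exp (↑(2 * Real.pi * ⟪ξ, x⟫) * Complex.I) • Φ ξ := by
  have hc : Continuous fun ξ : E3 => Complex.exp (↑(2 * Real.pi * ⟪ξ, x⟫) * Complex.I) := by
    fun_prop
  refine hΦ.norm.mono' (hc.aestronglyMeasurable.smul hΦ.aestronglyMeasurable) ?_
  refine Filter.Eventually.of_forall fun ξ => ?_
  rw [norm_smul, Complex.norm_exp_ofReal_mul_I, one_mul]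

/-- **Real-part inversion**: for continuous integrable `F : ℝ³ → ℂ` with integrable, REAL Fourier
transform, `Re F(x) = ∫ cos(2π⟪ξ, x⟫) · Re 𝓕F(ξ) dξ`. [folklore] -/
theorem re_eq_integral_cos_mul {F : E3 → ℂ} (hFc : Continuous F) (hFi : Integrable F)
    (hFF : Integrable (𝓕 F)) (hreal : ∀ ξ, (𝓕 F ξ).im = 0) (x : E3) :
    (F x).re = ∫ ξ : E3, Real.cos (2 * Real.pi * ⟪ξ, x⟫) * (𝓕 F ξ).re := by
  have hinv := hFc.fourierInv_fourier_eq hFi hFF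
  have hx := congrFun hinv x
  rw [Real.fourierInv_eq'] at hx
  rw [← hx]
  have h1 := integral_re (integrable_exp_smul hFF x)
  simp only [RCLike.re_to_complex] at h1
  rw [← h1]
  refine integral_congr_ae (Filter.Eventually.of_forall fun ξ => ?_)
  simp only [smul_eq_mul, Complex.mul_re, Complex.exp_ofReal_mul_I_re, Complex.exp_ofReal_mul_I_im,
    hreal ξ, mul_zero, sub_zero]

/-- **The drop of the kernel as a Fourier integral**: `Re F(0) − Re F(x) = ∫ (1 − cos(2π⟪ξ,x⟫)) Re 𝓕F(ξ) dξ`.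
[folklore] -/
theorem re_zero_sub_re_eq_integral {F : E3 → ℂ} (hFc : Continuous F) (hFi : Integrable F)
    (hFF : Integrable (𝓕 F)) (hreal : ∀ ξ, (𝓕 F ξ).im = 0) (x : E3) :
    (F 0).re - (F x).re = ∫ ξ : E3, (1 - Real.cos (2 * Real.pi * ⟪ξ, x⟫)) * (𝓕 F ξ).re := by
  have hre : Integrable fun ξ : E3 => (𝓕 F ξ).re := hFF.re
  have hcos : Integrable fun ξ : E3 => Real.cos (2 * Real.pi * ⟪ξ, x⟫) * (𝓕 F ξ).re := by
    refine hre.bdd_mul (c := 1) ?_ ?_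
    · exact (Continuous.aestronglyMeasurable (by fun_prop))
    · exact Filter.Eventually.of_forall fun ξ => by
        rw [Real.norm_eq_abs]; exact Real.abs_cos_le_one _
  rw [re_eq_integral_cos_mul hFc hFi hFF hreal 0, re_eq_integral_cos_mul hFc hFi hFF hreal x,
    ← integral_sub ?_ hcos]
  · refine integral_congr_ae (Filter.Eventually.of_forall fun ξ => ?_)
    simp only [inner_zero_right, mul_zero, Real.cos_zero, one_mul]
    ring
  · simpa only [inner_zero_right, mul_zero, Real.cos_zero, one_mul] using hre



/-- **Directional second Fourier moment from flatness (Fatou).**  Let `F : ℝ³ → ℂ` be continuous and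
integrable with integrable Fourier transform which is REAL and NON-NEGATIVE, let `e ∈ ℝ³`, and suppose
`Re F(0) − Re F(r • e) ≤ K r²` for `0 ≤ r ≤ δ` (`δ > 0`).  Then `ξ ↦ ⟪ξ, e⟫² · Re 𝓕F(ξ)` is integrable
and `∫ ⟪ξ, e⟫² Re 𝓕F(ξ) dξ ≤ K / (2π²)`. [folklore] -/
theorem integrable_inner_sq_mul_fourier {F : E3 → ℂ} (hFc : Continuous F) (hFi : Integrable F)
    (hFF : Integrable (𝓕 F)) (hreal : ∀ ξ, (𝓕 F ξ).im = 0) (hpos : ∀ ξ, 0 ≤ (𝓕 F ξ).re)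
    (e : E3) {K δ : ℝ} (hδ : 0 < δ)
    (hflat : ∀ r : ℝ, 0 ≤ r → r ≤ δ → (F 0).re - (F (r • e)).re ≤ K * r ^ 2) :
    Integrable (fun ξ : E3 => ⟪ξ, e⟫ ^ 2 * (𝓕 F ξ).re) ∧
    ∫ ξ : E3, ⟪ξ, e⟫ ^ 2 * (𝓕 F ξ).re ≤ K / (2 * Real.pi ^ 2) := by
  set φ : E3 → ℝ := fun ξ => (𝓕 F ξ).re with hφ
  have hφi : Integrable φ := hFF.re
  have hφm : AEStronglyMeasurable φ volume := hφi.aestronglyMeasurable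
  -- the radii `r n = δ/(n+1)` and the difference quotients `G n`
  set r : ℕ → ℝ := fun n => δ / ((n : ℝ) + 1) with hr
  have hrpos : ∀ n, 0 < r n := fun n => by rw [hr]; positivity
  have hrle : ∀ n, r n ≤ δ := fun n => by
    rw [hr]
    exact div_le_self hδ.le (by linarith [(Nat.cast_nonneg n : (0 : ℝ) ≤ n)])
  have hrt : Tendsto r atTop (𝓝[≠] 0) := by
    refine tendsto_nhdsWithin_iff.2 ⟨?_, Filter.Eventually.of_forall fun n => (hrpos n).ne'⟩
    have h1 : Tendsto (fun n : ℕ => ((n : ℝ) + 1)⁻¹) atTop (𝓝 0) := by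
      have := tendsto_one_div_add_atTop_nhds_zero_nat (𝕜 := ℝ)
      simpa only [one_div] using this
    have h2 := h1.const_mul δ
    rw [mul_zero] at h2
    refine h2.congr fun n => ?_
    show δ * ((n : ℝ) + 1)⁻¹ = δ / ((n : ℝ) + 1)
    rw [div_eq_mul_inv]
  set θ : E3 → ℝ := fun ξ => 2 * Real.pi * ⟪ξ, e⟫ with hθ
  have hθc : Continuous θ := by rw [hθ]; fun_prop
  set G : ℕ → E3 → ℝ := fun n ξ => (r n)⁻¹ ^ 2 * (1 - Real.cos (r n * θ ξ)) * φ ξ with hG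
  have hG0 : ∀ n ξ, 0 ≤ G n ξ := fun n ξ => by
    rw [hG]
    have h1 : 0 ≤ 1 - Real.cos (r n * θ ξ) := by linarith [Real.cos_le_one (r n * θ ξ)]
    have h2 : 0 ≤ (r n)⁻¹ ^ 2 := by positivity
    exact mul_nonneg (mul_nonneg h2 h1) (hpos ξ)
  -- `G n` is integrable (bounded multiple of `φ`) and `∫ G n ≤ K`
  have hGi : ∀ n, Integrable (G n) := fun n => by
    rw [hG]
    refine hφi.bdd_mul (c := (r n)⁻¹ ^ 2 * 2) ?_ ?_
    · exact Continuous.aestronglyMeasurable (by fun_prop)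
    · refine Filter.Eventually.of_forall fun ξ => ?_
      rw [Real.norm_eq_abs, abs_mul, abs_of_nonneg (by positivity : (0 : ℝ) ≤ (r n)⁻¹ ^ 2)]
      refine mul_le_mul_of_nonneg_left ?_ (by positivity)
      rw [abs_le]
      constructor <;> linarith [Real.cos_le_one (r n * θ ξ), Real.neg_one_le_cos (r n * θ ξ)]
  have hGint : ∀ n, ∫ ξ, G n ξ ≤ K := fun n => by
    have h1 := re_zero_sub_re_eq_integral hFc hFi hFF hreal ((r n) • e)
    have h2 : ∫ ξ, G n ξ = (r n)⁻¹ ^ 2 * ((F 0).re - (F ((r n) • e)).re) := by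
      rw [h1, ← integral_const_mul]
      refine integral_congr_ae (Filter.Eventually.of_forall fun ξ => ?_)
      simp only [hG, hθ, hφ, inner_smul_right]
      ring_nf
    rw [h2]
    have h3 := hflat (r n) (hrpos n).le (hrle n)
    have h4 : (r n)⁻¹ ^ 2 * (K * r n ^ 2) = K := by
      field_simp [(hrpos n).ne']
    calc (r n)⁻¹ ^ 2 * ((F 0).re - (F (r n • e)).re)
        ≤ (r n)⁻¹ ^ 2 * (K * r n ^ 2) := mul_le_mul_of_nonneg_left h3 (by positivity)
      _ = K := h4
  -- `K ≥ 0`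
  have hK : 0 ≤ K := by
    have h1 : 0 ≤ ∫ ξ, G 0 ξ := integral_nonneg (hG0 0)
    exact h1.trans (hGint 0)
  -- pointwise limit `G n ξ → (θ ξ)²/2 · φ ξ`
  set Ginf : E3 → ℝ := fun ξ => (θ ξ) ^ 2 / 2 * φ ξ with hGinf
  have hlim : ∀ ξ, Tendsto (fun n => G n ξ) atTop (𝓝 (Ginf ξ)) := fun ξ => by
    have h1 := (tendsto_inv_sq_mul_cos_sub_one (θ ξ)).comp hrt
    have h2 := (h1.neg).mul_const (φ ξ)
    rw [neg_neg] at h2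
    refine h2.congr fun n => ?_
    simp only [Function.comp_apply, hG]
    ring
  -- Fatou
  have hmeas : ∀ n, AEMeasurable (fun ξ => ENNReal.ofReal (G n ξ)) volume := fun n =>
    (hGi n).aestronglyMeasurable.aemeasurable.ennreal_ofReal
  have hfatou := lintegral_liminf_le' (u := atTop) hmeas
  have hliminf : ∀ ξ, liminf (fun n => ENNReal.ofReal (G n ξ)) atTop = ENNReal.ofReal (Ginf ξ) :=
    fun ξ => ((ENNReal.continuous_ofReal.tendsto _).comp (hlim ξ)).liminf_eq
  simp_rw [hliminf] at hfatou
  have hbound : liminf (fun n => ∫⁻ ξ, ENNReal.ofReal (G n ξ)) atTop ≤ ENNReal.ofReal K := by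
    refine liminf_le_of_frequently_le' (Filter.Frequently.of_forall fun n => ?_)
    rw [← ofReal_integral_eq_lintegral_ofReal (hGi n) (Filter.Eventually.of_forall (hG0 n))]
    exact ENNReal.ofReal_le_ofReal (hGint n)
  have hlin : ∫⁻ ξ, ENNReal.ofReal (Ginf ξ) ≤ ENNReal.ofReal K := hfatou.trans hbound
  -- integrability of the limit and the bound on its integral
  have hGinf0 : ∀ ξ, 0 ≤ Ginf ξ := fun ξ => by rw [hGinf]; exact mul_nonneg (by positivity) (hpos ξ)
  have hGinfm : AEStronglyMeasurable Ginf volume := by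
    rw [hGinf]
    exact (Continuous.aestronglyMeasurable (by fun_prop)).mul hφm
  have hGinfi : Integrable Ginf := by
    refine ⟨hGinfm, (hasFiniteIntegral_iff_ofReal (Filter.Eventually.of_forall hGinf0)).2 ?_⟩
    exact hlin.trans_lt ENNReal.ofReal_lt_top
  have hGinfint : ∫ ξ, Ginf ξ ≤ K := by
    have h1 := ofReal_integral_eq_lintegral_ofReal hGinfi (Filter.Eventually.of_forall hGinf0)
    rw [← h1] at hlin
    exact (ENNReal.ofReal_le_ofReal_iff hK).1 hlin
  -- `Ginf = 2π² ⟪·, e⟫² φ`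
  have hid : Ginf = fun ξ => (2 * Real.pi ^ 2) * (⟪ξ, e⟫ ^ 2 * φ ξ) := by
    funext ξ
    simp only [hGinf, hθ]
    ring
  have hpi : (0 : ℝ) < 2 * Real.pi ^ 2 := by positivity
  rw [hid] at hGinfi hGinfint
  have hI : Integrable (fun ξ : E3 => ⟪ξ, e⟫ ^ 2 * φ ξ) := by
    have := hGinfi.const_mul (2 * Real.pi ^ 2)⁻¹
    refine this.congr (Filter.Eventually.of_forall fun ξ => ?_)
    show (2 * Real.pi ^ 2)⁻¹ * ((2 * Real.pi ^ 2) * (⟪ξ, e⟫ ^ 2 * φ ξ)) = ⟪ξ, e⟫ ^ 2 * φ ξ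
    rw [← mul_assoc, inv_mul_cancel₀ hpi.ne', one_mul]
  refine ⟨hI, ?_⟩
  rw [integral_const_mul] at hGinfint
  rw [le_div_iff₀ hpi]
  linarith


/-- `‖ξ‖² = Σᵢ ⟪ξ, eᵢ⟫²` over the standard basis `eᵢ = single i 1` of `ℝ³`. [folklore] -/
theorem norm_sq_eq_sum_inner_single_sq (ξ : E3) :
    ‖ξ‖ ^ 2 = ∑ i : Fin 3, ⟪ξ, EuclideanSpace.single i (1 : ℝ)⟫ ^ 2 := by
  rw [EuclideanSpace.norm_sq_eq]
  refine Finset.sum_congr rfl fun i _ => ?_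
  rw [EuclideanSpace.inner_single_right, Real.norm_eq_abs, sq_abs, one_mul]
  simp

/-- **Finite second Fourier moment from flatness in the coordinate directions.**  Under the hypotheses
of `integrable_inner_sq_mul_fourier` for the three vectors `eᵢ = single i 1`:
`ξ ↦ ‖ξ‖² Re 𝓕F(ξ)` is integrable and `∫ ‖ξ‖² Re 𝓕F(ξ) dξ ≤ 3K/(2π²)`. [folklore] -/
theorem integrable_norm_sq_mul_fourier {F : E3 → ℂ} (hFc : Continuous F) (hFi : Integrable F)
    (hFF : Integrable (𝓕 F)) (hreal : ∀ ξ, (𝓕 F ξ).im = 0) (hpos : ∀ ξ, 0 ≤ (𝓕 F ξ).re)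
    {K δ : ℝ} (hδ : 0 < δ)
    (hflat : ∀ (i : Fin 3) (r : ℝ), 0 ≤ r → r ≤ δ →
      (F 0).re - (F (r • EuclideanSpace.single i (1 : ℝ))).re ≤ K * r ^ 2) :
    Integrable (fun ξ : E3 => ‖ξ‖ ^ 2 * (𝓕 F ξ).re) ∧
    ∫ ξ : E3, ‖ξ‖ ^ 2 * (𝓕 F ξ).re ≤ 3 * K / (2 * Real.pi ^ 2) := by
  have hdir : ∀ i : Fin 3,
      Integrable (fun ξ : E3 => ⟪ξ, EuclideanSpace.single i (1 : ℝ)⟫ ^ 2 * (𝓕 F ξ).re) ∧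
      ∫ ξ : E3, ⟪ξ, EuclideanSpace.single i (1 : ℝ)⟫ ^ 2 * (𝓕 F ξ).re ≤ K / (2 * Real.pi ^ 2) :=
    fun i => integrable_inner_sq_mul_fourier hFc hFi hFF hreal hpos _ hδ (hflat i)
  have hfun : (fun ξ : E3 => ‖ξ‖ ^ 2 * (𝓕 F ξ).re) =
      fun ξ => ∑ i : Fin 3, ⟪ξ, EuclideanSpace.single i (1 : ℝ)⟫ ^ 2 * (𝓕 F ξ).re := by
    funext ξ
    rw [norm_sq_eq_sum_inner_single_sq, Finset.sum_mul]
  rw [hfun]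
  refine ⟨integrable_finsetSum _ fun i _ => (hdir i).1, ?_⟩
  rw [integral_finsetSum _ fun i _ => (hdir i).1]
  calc ∑ i : Fin 3, ∫ ξ : E3, ⟪ξ, EuclideanSpace.single i (1 : ℝ)⟫ ^ 2 * (𝓕 F ξ).re
      ≤ ∑ _i : Fin 3, K / (2 * Real.pi ^ 2) := Finset.sum_le_sum fun i _ => (hdir i).2
    _ = 3 * K / (2 * Real.pi ^ 2) := by
        rw [Finset.sum_const, Finset.card_univ, Fintype.card_fin, nsmul_eq_mul]
        push_cast
        ring


/-- **Moments up to order two make the inverse transform `C²`.**  If `Φ : ℝ³ → ℂ` and `‖ξ‖² ‖Φ ξ‖` are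
integrable then `𝓕⁻ Φ ∈ C²(ℝ³)` (`Real.contDiff_fourier` after `𝓕⁻ Φ = 𝓕 (Φ ∘ neg)`; the first
moment is dominated by the sum of the zeroth and the second). [folklore] -/
theorem contDiff_two_fourierInv {Φ : E3 → ℂ} (h0 : Integrable Φ)
    (h2 : Integrable fun ξ : E3 => ‖ξ‖ ^ 2 * ‖Φ ξ‖) : ContDiff ℝ 2 (𝓕⁻ Φ) := by
  rw [Real.fourierInv_eq_fourier_comp_neg]
  refine Real.contDiff_fourier fun n hn => ?_
  have h0' : Integrable (fun ξ : E3 => ‖Φ (-ξ)‖) := h0.norm.comp_neg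
  have h2' : Integrable (fun ξ : E3 => ‖ξ‖ ^ 2 * ‖Φ (-ξ)‖) := by
    have := h2.comp_neg
    simpa only [norm_neg] using this
  have hn' : n ≤ 2 := by exact_mod_cast hn
  interval_cases n
  · simpa only [pow_zero, one_mul] using h0'
  · -- `‖ξ‖ ≤ 1 + ‖ξ‖²`
    refine (h0'.add h2').mono' ?_ (Filter.Eventually.of_forall fun ξ => ?_)
    · exact (continuous_norm.pow 1).aestronglyMeasurable.mul h0'.aestronglyMeasurable
    · rw [Real.norm_eq_abs, abs_of_nonneg (by positivity), pow_one, Pi.add_apply]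
      have h1 : ‖ξ‖ ≤ 1 + ‖ξ‖ ^ 2 := by nlinarith [norm_nonneg ξ, sq_nonneg (‖ξ‖ - 1)]
      have h3 : 0 ≤ ‖Φ (-ξ)‖ := norm_nonneg _
      nlinarith [mul_le_mul_of_nonneg_right h1 h3]
  · exact h2'

/-- For a REAL transform, `‖𝓕F ξ‖ = |Re 𝓕F ξ|`; with `Re 𝓕F ≥ 0` it is `Re 𝓕F ξ`. [folklore] -/
theorem norm_fourier_eq_re {F : E3 → ℂ} (hreal : ∀ ξ, (𝓕 F ξ).im = 0)
    (hpos : ∀ ξ, 0 ≤ (𝓕 F ξ).re) (ξ : E3) : ‖𝓕 F ξ‖ = (𝓕 F ξ).re := by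
  have h1 : 𝓕 F ξ = ((𝓕 F ξ).re : ℂ) := Complex.ext (by simp) (by simp [hreal ξ])
  rw [h1, Complex.norm_real, Real.norm_eq_abs, abs_of_nonneg (hpos ξ)]
  simp

/-- **`F ∈ C²(ℝ³)` from flatness**: under the hypotheses of `integrable_norm_sq_mul_fourier`,
`F = 𝓕⁻(𝓕F)` is twice continuously differentiable. [folklore] -/
theorem contDiff_two_of_flat {F : E3 → ℂ} (hFc : Continuous F) (hFi : Integrable F)
    (hFF : Integrable (𝓕 F)) (hreal : ∀ ξ, (𝓕 F ξ).im = 0) (hpos : ∀ ξ, 0 ≤ (𝓕 F ξ).re)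
    {K δ : ℝ} (hδ : 0 < δ)
    (hflat : ∀ (i : Fin 3) (r : ℝ), 0 ≤ r → r ≤ δ →
      (F 0).re - (F (r • EuclideanSpace.single i (1 : ℝ))).re ≤ K * r ^ 2) :
    ContDiff ℝ 2 F := by
  have h2 := (integrable_norm_sq_mul_fourier hFc hFi hFF hreal hpos hδ hflat).1
  have h2' : Integrable fun ξ : E3 => ‖ξ‖ ^ 2 * ‖𝓕 F ξ‖ :=
    h2.congr (Filter.Eventually.of_forall fun ξ => by
      show ‖ξ‖ ^ 2 * (𝓕 F ξ).re = ‖ξ‖ ^ 2 * ‖𝓕 F ξ‖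
      rw [norm_fourier_eq_re hreal hpos])
  have hinv := hFc.fourierInv_fourier_eq hFi hFF
  rw [← hinv]
  exact contDiff_two_fourierInv hFF h2'

/-! ## §2 Application to witnesses of the crux -/

/-- **For a witness of `StrictCertificate` the transform has a finite second moment, quantitatively**:
with the flatness data `K, δ` of `…Flatness.f_zero_sub_f_le_mul_sq`,
`∫ ‖ξ‖² Re 𝓕F ≤ 3K/(2π²)` and `ξ ↦ ‖ξ‖² Re 𝓕F(ξ)` is integrable. [folklore] -/
theorem integrable_norm_sq_mul_fourier_of_isSplit {P : PeriodicConfiguration 3} {ρ c : ℝ}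
    {g U f : ℝ → ℝ} (h : IsSplit ρ c g U f) (hv : c + f 0 / 2 ≤ -(P.energyPerParticle lennardJones))
    (hFc : Continuous fun v : E3 => (f ‖v‖ : ℂ)) (hFi : Integrable fun v : E3 => (f ‖v‖ : ℂ))
    (hFF : Integrable (𝓕 fun v : E3 => (f ‖v‖ : ℂ)))
    (h13 : ∀ ξ : E3, (𝓕 (fun v : E3 => (f ‖v‖ : ℂ)) ξ).im = 0 ∧
      0 ≤ (𝓕 (fun v : E3 => (f ‖v‖ : ℂ)) ξ).re) :
    ∃ K δ : ℝ, 0 < δ ∧ (∀ r : ℝ, 0 ≤ r → r ≤ δ → 0 ≤ f 0 - f r ∧ f 0 - f r ≤ K * r ^ 2) ∧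
      Integrable (fun ξ : E3 => ‖ξ‖ ^ 2 * (𝓕 (fun v : E3 => (f ‖v‖ : ℂ)) ξ).re) ∧
      ∫ ξ : E3, ‖ξ‖ ^ 2 * (𝓕 (fun v : E3 => (f ‖v‖ : ℂ)) ξ).re ≤ 3 * K / (2 * Real.pi ^ 2) ∧
      ContDiff ℝ 2 (fun v : E3 => (f ‖v‖ : ℂ)) := by
  obtain ⟨K, δ, hδ, hflat⟩ := f_zero_sub_f_le_mul_sq h hv
  have hflat' : ∀ (i : Fin 3) (r : ℝ), 0 ≤ r → r ≤ δ →
      ((f ‖(0 : E3)‖ : ℂ)).re - ((f ‖r • EuclideanSpace.single i (1 : ℝ)‖ : ℂ)).re ≤ K * r ^ 2 := by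
    intro i r hr0 hrδ
    rw [norm_zero, norm_smul, PiLp.norm_single, norm_one, mul_one, Real.norm_of_nonneg hr0,
      Complex.ofReal_re, Complex.ofReal_re]
    exact (hflat r hr0 hrδ).2
  have key := integrable_norm_sq_mul_fourier hFc hFi hFF (fun ξ => (h13 ξ).1) (fun ξ => (h13 ξ).2)
    hδ hflat'
  exact ⟨K, δ, hδ, hflat, key.1, key.2,
    contDiff_two_of_flat hFc hFi hFF (fun ξ => (h13 ξ).1) (fun ξ => (h13 ξ).2) hδ hflat'⟩

/-- **Registered sub-goal `fourierSecondMoment_of_clauses`** (crux conjuncts 2–7 and 10–13 verbatim as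
hypotheses): for every witness of `StrictCertificate`, `ξ ↦ ‖ξ‖² Re 𝓕F(ξ)` is integrable on `ℝ³`
and `F = f∘‖·‖ ∈ C²(ℝ³)`. [folklore] -/
theorem fourierSecondMoment_of_clauses : ∀ (P : Literature.MathematicalPhysics.StatisticalMechanics.PeriodicConfiguration 3) (ρ c : ℝ) (g U f : ℝ → ℝ), (∀ r : ℝ, 0 < r → Literature.MathematicalPhysics.StatisticalMechanics.lennardJones r = g r + U r + f r) → (∀ r : ℝ, 0 < r → 0 ≤ U r) → (∀ r : ℝ, ρ ≤ r → g r = 0) → (∀ (n : ℕ) (y : Fin n → EuclideanSpace ℝ (Fin 3)) (w : Fin n → ℝ), 0 ≤ ∑ i, ∑ j, w i * w j * f (dist (y i) (y j))) → (∀ (N : ℕ) (x : Fin N → EuclideanSpace ℝ (Fin 3)), Function.Injective x → -(c * (N : ℝ)) ≤ Literature.MathematicalPhysics.StatisticalMechanics.interactionEnergy g x) → c + f 0 / 2 = -(P.energyPerParticle Literature.MathematicalPhysics.StatisticalMechanics.lennardJones) → Continuous (fun v : EuclideanSpace ℝ (Fin 3) => (f ‖v‖ : ℂ)) → MeasureTheory.Integrable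 (fun v : EuclideanSpace ℝ (Fin 3) => (f ‖v‖ : ℂ)) → MeasureTheory.Integrable (FourierTransform.fourier (fun v : EuclideanSpace ℝ (Fin 3) => (f ‖v‖ : ℂ))) → (∀ ξ : EuclideanSpace ℝ (Fin 3), (FourierTransform.fourier (fun v : EuclideanSpace ℝ (Fin 3) => (f ‖v‖ : ℂ)) ξ).im = 0 ∧ 0 ≤ (FourierTransform.fourier (fun v : EuclideanSpace ℝ (Fin 3) => (f ‖v‖ : ℂ)) ξ).re) → MeasureTheory.Integrable (fun ξ : EuclideanSpace ℝ (Fin 3) => ‖ξ‖ ^ 2 * (FourierTransform.fourier (fun v : EuclideanSpace ℝ (Fin 3) => (f ‖v‖ : ℂ)) ξ).re) ∧ ContDiff ℝ 2 (fun v : EuclideanSpace ℝ (Fin 3) => (f ‖v‖ : ℂ)) :=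
  fun _P _ρ _c _g _U _f h1 h2 h3 h4 h5 h6 hFc hFi hFF h13 => by
    obtain ⟨_, _, _, _, hI, _, hC⟩ :=
      integrable_norm_sq_mul_fourier_of_isSplit ⟨h1, h2, h3, h4, h5⟩ h6.le hFc hFi hFF h13
    exact ⟨hI, hC⟩

/-- **`StrictCertificate` forces a `C²` kernel with finite second Fourier moment** (the crux read
through this file). [folklore] -/
theorem fourierSecondMoment_of_strictCertificate
    (hS : Summit.AtomisticToContinuum.Crystallization.Theses.BraggSlacknessRigidity.StrictCertificate) :
    ∃ (P : PeriodicConfiguration 3) (f : ℝ → ℝ) (K δ : ℝ),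
      (∃ (a hh : ℝ) (ha : a ≠ 0) (hh' : hh ≠ 0), P = hcpPeriodicConfiguration ha hh') ∧ 0 < δ ∧
      (∀ r : ℝ, 0 ≤ r → r ≤ δ → 0 ≤ f 0 - f r ∧ f 0 - f r ≤ K * r ^ 2) ∧
      Integrable (fun ξ : E3 => ‖ξ‖ ^ 2 * (𝓕 (fun v : E3 => (f ‖v‖ : ℂ)) ξ).re) ∧
      ∫ ξ : E3, ‖ξ‖ ^ 2 * (𝓕 (fun v : E3 => (f ‖v‖ : ℂ)) ξ).re ≤ 3 * K / (2 * Real.pi ^ 2) ∧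
      ContDiff ℝ 2 (fun v : E3 => (f ‖v‖ : ℂ)) := by
  obtain ⟨P, ρ, c, g, U, f, hP, h1, h2, h3, h4, h5, h6, -, -, hFc, hFi, hFF, h13, -⟩ := hS
  obtain ⟨K, δ, hδ, hflat, hI, hint, hC⟩ :=
    integrable_norm_sq_mul_fourier_of_isSplit ⟨h1, h2, h3, h4, h5⟩ h6.le hFc hFi hFF h13
  exact ⟨P, f, K, δ, hP, hδ, hflat, hI, hint, hC⟩

end Summit.AtomisticToContinuum.Crystallization.Theorems.BraggSlacknessRigidityStrictCertificate

end
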